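import Literature.MathematicalPhysics.QuantumLattice.FreeFermionTwistedTraceFormula
import Literature.MathematicalPhysics.QuantumLattice.SpinTwistedHubbardTorus
import HarnessLib

/-!
# The spin-twisted free-fermion trace formula `tr (e^{φ N↑ + χ N↓} e^{-β dΓ(h₀ ⊕ h₀)}) = ∏_σ det(1 + e^{f_σ} e^{-βh₀})`

Topic `Literature/MathematicalPhysics/QuantumLattice`, companion of `FreeFermionTwistedTraceFormula`
(the one-species formula `tr (e^{cN} e^{-β dΓ(h)}) = det(1 + e^{c} e^{-βh})`). For fermions with
orbitals `Orb Λ = Λ ×ₗ Fin 2` (site, spin) and a SPIN-INDEPENDENT, spin-diagonal one-body matrix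
`h₀ ⊕ h₀` (`Matrix.reindex toLex toLex (blockDiagonal fun _ => h₀)`, e.g. the free Hubbard model,
`hubbardOneBody_eq_reindex_blockDiagonal`), the trace twisted by INDEPENDENT phases for the two
spin species factorises:

* `trace_exp_spinTwist_mul_gibbsWeight_dGamma` — for Hermitian `h₀ : Matrix Λ Λ ℂ`, real `β` and
  `f : Fin 2 → ℂ`,
  `tr (exp (Σ_σ f_σ N_σ) · e^{-β dΓ(h₀ ⊕ h₀)}) = ∏_σ det(1 + e^{f_σ} e^{-βh₀})`, `N_σ = Σ_x n_{xσ}`;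
  with `f = (iφ, iχ)` these are the twisted traces of the `U(1) × U(1)` (charge and spin) number
  projections, with `f_σ = βμ_σ` spin-resolved grand-canonical weights;
* `trace_exp_spinTwist_mul_gibbsWeight_freeHubbard` — the same for `hamiltonianWith G t 0 μ`
  (the Hubbard model at `U = 0`), whose one-body matrix is `h_sp ⊕ h_sp`,
  `h_sp = -t·[x ∼ y] - μ δ_{xy}`;
* `exp_sum_smul_spinNumber_eq_diagonal` — the twist is `diag (e^{f_↑ #↑s + f_↓ #↓s})` (the form
  used by the sector-projection formula of `Summits/…/BalabanIRBirGappedPhaseReductionSectorFourier`).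

Method: the twist generator `Σ_σ f_σ N_σ` is `dΓ(D)`, `D = diag(f_{σ(o)})` (`sum_smul_spinNumber_eq_dGamma`);
`D` commutes with `h₀ ⊕ h₀`, so the product of exponentials is `e^{dΓ(D - β(h₀ ⊕ h₀))}`; the normal
matrix `D - β(h₀ ⊕ h₀) = ⊕_σ (f_σ 1 - βh₀)` is diagonalised by the unitary `U₀ ⊕ U₀` (`U₀` an
eigenvector unitary of `h₀`), and `trace_exp_dGamma_unitary_conj_diagonal` (the trace formula for a
unitarily diagonalised one-body matrix) gives `det(1 + e^{⊕_σ(f_σ1 - βh₀)}) = ∏_σ det(1 + e^{f_σ}e^{-βh₀})`.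
All statements PROVED; no definition is introduced (the spin lift is Mathlib's
`reindex toLex toLex ∘ blockDiagonal`).

Sources: J. Dereziński, C. Gérard, *Mathematics of Quantization and Quantum Fields* (CUP
2013/2022), §17.2 (`Tr Γ(γ) = det(𝟙 + γ)`); O. Bratteli, D. W. Robinson, *Operator Algebras and
Quantum Statistical Mechanics 2* (1997) §5.2.1. Folklore.
-/

noncomputable section

open NormedSpace Matrix Finset
open scoped ComplexOrder

namespace Literature.MathematicalPhysics.QuantumLattice

variable {Λ : Type*} [LinearOrder Λ] [Fintype Λ]

/-! ### Sums over orbitals, the twist generator -/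

omit [LinearOrder Λ] [Fintype Λ] in
/-- `ofLex (orb x σ) = (x, σ)`. [folklore] -/
theorem ofLex_orb (x : Λ) (σ : Fin 2) : ofLex (orb x σ) = (x, σ) := rfl

omit [LinearOrder Λ] in
/-- Sums over orbitals are iterated sums over sites and spins. [folklore] -/
theorem sum_orb_eq_sum_sum {M : Type*} [AddCommMonoid M] (g : Orb Λ → M) :
    ∑ o, g o = ∑ x : Λ, ∑ σ : Fin 2, g (orb x σ) := by
  rw [← Fintype.sum_prod_type', ← (toLex : Λ × Fin 2 ≃ Orb Λ).sum_comp]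

omit [LinearOrder Λ] in
/-- Products over orbitals are iterated products over sites and spins. [folklore] -/
theorem prod_orb_eq_prod_prod {M : Type*} [CommMonoid M] (g : Orb Λ → M) :
    ∏ o, g o = ∏ x : Λ, ∏ σ : Fin 2, g (orb x σ) := by
  rw [← Fintype.prod_prod_type', ← (toLex : Λ × Fin 2 ≃ Orb Λ).prod_comp]

/-- **The spin-twist generator is `dΓ` of a diagonal one-body matrix**:
`Σ_σ f_σ N_σ = dΓ(diag (f_{σ(o)}))`, `N_σ = Σ_x n_{xσ}`. [folklore] -/
theorem sum_smul_spinNumber_eq_dGamma (f : Fin 2 → ℂ) :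
    ∑ σ : Fin 2, f σ • ∑ x : Λ, numberAt (orb x σ) =
      dGamma (diagonal fun o : Orb Λ => f (ofLex o).2) := by
  rw [dGamma_diagonal, sum_orb_eq_sum_sum, Finset.sum_comm]
  simp only [Finset.smul_sum]
  rfl

/-- **The spin twist is diagonal in the occupation basis**:
`exp (Σ_σ f_σ N_σ) |s⟩ = e^{f_↑ #↑s + f_↓ #↓s} |s⟩` (`#↑s`, `#↓s` = `upPart`, `downPart` cardinalities;
for `f = (iφ, iχ)` this is the twist `diag (e^{i(φ #↑s + χ #↓s)})` of the sector-projection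
formula). [folklore] -/
theorem exp_sum_smul_spinNumber_eq_diagonal (f : Fin 2 → ℂ) :
    exp (∑ σ : Fin 2, f σ • ∑ x : Λ, numberAt (orb x σ)) =
      diagonal fun s : Finset (Orb Λ) =>
        Complex.exp (f 0 * (upPart s).card + f 1 * (downPart s).card) := by
  have h0 : (∑ x : Λ, numberAt (orb x 0) : Matrix (Finset (Orb Λ)) (Finset (Orb Λ)) ℂ) =
      ∑ x : Λ, numberOp x 0 := rfl
  have h1 : (∑ x : Λ, numberAt (orb x 1) : Matrix (Finset (Orb Λ)) (Finset (Orb Λ)) ℂ) =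
      ∑ x : Λ, numberOp x 1 := rfl
  rw [Fin.sum_univ_two, h0, h1, sum_numberOp_zero_eq_diagonal, sum_numberOp_one_eq_diagonal,
    ← diagonal_smul, ← diagonal_smul, diagonal_add, Matrix.exp_diagonal]
  congr 1
  funext s
  rw [Pi.exp_def, Complex.exp_eq_exp_ℂ]
  simp only [Pi.smul_apply, smul_eq_mul]

/-! ### The spin lift `M ↦ ⊕_σ M_σ` (`reindex toLex toLex ∘ blockDiagonal`) -/

omit [LinearOrder Λ] [Fintype Λ] in
/-- Entries of the spin lift: `(⊕_σ M_σ)_{o o'} = [σ(o) = σ(o')] (M_{σ(o)})_{x(o) x(o')}`. [folklore] -/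
theorem reindex_blockDiagonal_apply (M : Fin 2 → Matrix Λ Λ ℂ) (o o' : Orb Λ) :
    Matrix.reindex (toLex : Λ × Fin 2 ≃ Orb Λ) toLex (blockDiagonal M) o o' =
      if (ofLex o).2 = (ofLex o').2 then M (ofLex o).2 (ofLex o).1 (ofLex o').1 else 0 := rfl

/-- The spin lift is multiplicative. [folklore] -/
theorem reindex_blockDiagonal_mul (M N : Fin 2 → Matrix Λ Λ ℂ) :
    Matrix.reindex (toLex : Λ × Fin 2 ≃ Orb Λ) toLex (blockDiagonal M) *
        Matrix.reindex (toLex : Λ × Fin 2 ≃ Orb Λ) toLex (blockDiagonal N) =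
      Matrix.reindex (toLex : Λ × Fin 2 ≃ Orb Λ) toLex (blockDiagonal fun σ => M σ * N σ) := by
  rw [blockDiagonal_mul]
  exact (map_mul (Matrix.reindexAlgEquiv ℂ ℂ (toLex : Λ × Fin 2 ≃ Orb Λ)) _ _).symm

omit [LinearOrder Λ] [Fintype Λ] in
/-- The spin lift commutes with the adjoint. [folklore] -/
theorem reindex_blockDiagonal_conjTranspose (M : Fin 2 → Matrix Λ Λ ℂ) :
    (Matrix.reindex (toLex : Λ × Fin 2 ≃ Orb Λ) toLex (blockDiagonal M))ᴴ =
      Matrix.reindex (toLex : Λ × Fin 2 ≃ Orb Λ) toLex (blockDiagonal fun σ => (M σ)ᴴ) := by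
  rw [conjTranspose_reindex, blockDiagonal_conjTranspose]

/-- The spin lift of the identity family is the identity. [folklore] -/
theorem reindex_blockDiagonal_one :
    Matrix.reindex (toLex : Λ × Fin 2 ≃ Orb Λ) toLex (blockDiagonal fun _ : Fin 2 =>
      (1 : Matrix Λ Λ ℂ)) = 1 := by
  rw [show (fun _ : Fin 2 => (1 : Matrix Λ Λ ℂ)) = 1 from rfl, blockDiagonal_one]
  exact map_one (Matrix.reindexAlgEquiv ℂ ℂ (toLex : Λ × Fin 2 ≃ Orb Λ))

/-- The spin lift is additive. [folklore] -/
theorem reindex_blockDiagonal_add (M N : Fin 2 → Matrix Λ Λ ℂ) :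
    Matrix.reindex (toLex : Λ × Fin 2 ≃ Orb Λ) toLex (blockDiagonal M) +
        Matrix.reindex (toLex : Λ × Fin 2 ≃ Orb Λ) toLex (blockDiagonal N) =
      Matrix.reindex (toLex : Λ × Fin 2 ≃ Orb Λ) toLex (blockDiagonal fun σ => M σ + N σ) := by
  rw [show (fun σ => M σ + N σ) = M + N from rfl, blockDiagonal_add]
  exact (map_add (Matrix.reindexAlgEquiv ℂ ℂ (toLex : Λ × Fin 2 ≃ Orb Λ)) _ _).symm

/-- The spin lift respects differences. [folklore] -/
theorem reindex_blockDiagonal_sub (M N : Fin 2 → Matrix Λ Λ ℂ) :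
    Matrix.reindex (toLex : Λ × Fin 2 ≃ Orb Λ) toLex (blockDiagonal M) -
        Matrix.reindex (toLex : Λ × Fin 2 ≃ Orb Λ) toLex (blockDiagonal N) =
      Matrix.reindex (toLex : Λ × Fin 2 ≃ Orb Λ) toLex (blockDiagonal fun σ => M σ - N σ) := by
  rw [show (fun σ => M σ - N σ) = M - N from rfl, blockDiagonal_sub]
  exact (map_sub (Matrix.reindexAlgEquiv ℂ ℂ (toLex : Λ × Fin 2 ≃ Orb Λ)) _ _).symm

omit [LinearOrder Λ] [Fintype Λ] in
/-- The spin lift is homogeneous. [folklore] -/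
theorem reindex_blockDiagonal_smul (c : ℂ) (M : Fin 2 → Matrix Λ Λ ℂ) :
    c • Matrix.reindex (toLex : Λ × Fin 2 ≃ Orb Λ) toLex (blockDiagonal M) =
      Matrix.reindex (toLex : Λ × Fin 2 ≃ Orb Λ) toLex (blockDiagonal fun σ => c • M σ) := by
  rw [show (fun σ => c • M σ) = c • M from rfl, blockDiagonal_smul]
  rfl

omit [Fintype Λ] in
/-- The spin lift of a family of diagonal matrices is diagonal. [folklore] -/
theorem reindex_blockDiagonal_diagonal (v : Fin 2 → Λ → ℂ) :
    Matrix.reindex (toLex : Λ × Fin 2 ≃ Orb Λ) toLex (blockDiagonal fun σ => diagonal (v σ)) =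
      diagonal fun o : Orb Λ => v (ofLex o).2 (ofLex o).1 := by
  rw [blockDiagonal_diagonal, reindex_apply, submatrix_diagonal_equiv]
  rfl

/-- The determinant of a spin lift is the product of the determinants. [folklore] -/
theorem det_reindex_blockDiagonal (M : Fin 2 → Matrix Λ Λ ℂ) :
    (Matrix.reindex (toLex : Λ × Fin 2 ≃ Orb Λ) toLex (blockDiagonal M)).det = ∏ σ, (M σ).det := by
  rw [det_reindex_self, det_blockDiagonal]

/-- The diagonal twist `diag(f_{σ(o)})` commutes with any spin lift of a CONSTANT family
`h₀ ⊕ h₀`. [folklore] -/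
theorem commute_diagonal_spin_reindex_blockDiagonal (f : Fin 2 → ℂ) (h₀ : Matrix Λ Λ ℂ) :
    Commute (diagonal fun o : Orb Λ => f (ofLex o).2)
      (Matrix.reindex (toLex : Λ × Fin 2 ≃ Orb Λ) toLex (blockDiagonal fun _ : Fin 2 => h₀)) := by
  have hD : (diagonal fun o : Orb Λ => f (ofLex o).2) =
      Matrix.reindex (toLex : Λ × Fin 2 ≃ Orb Λ) toLex (blockDiagonal fun σ => f σ • 1) := by
    rw [← reindex_blockDiagonal_diagonal (fun σ _ => f σ)]
    congr 2
    funext σ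
    exact (smul_one_eq_diagonal (f σ)).symm
  rw [hD, Commute, SemiconjBy, reindex_blockDiagonal_mul, reindex_blockDiagonal_mul]
  congr 2
  funext σ
  rw [Matrix.smul_mul, Matrix.mul_smul, Matrix.one_mul, Matrix.mul_one]

/-! ### The spin-twisted trace formula -/

open scoped Matrix.Norms.L2Operator in
/-- The Gibbs weight of a Hermitian matrix in its eigenbasis:
`e^{-βh} = U diag(e^{-βλ}) U⋆`. [folklore] -/
theorem gibbsWeight_eq_eigenvectorUnitary_mul_diagonal {h : Matrix Λ Λ ℂ} (hh : h.IsHermitian)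
    (β : ℝ) :
    gibbsWeight β h = (hh.eigenvectorUnitary : Matrix Λ Λ ℂ) *
      diagonal (fun x => (Real.exp (-(β * hh.eigenvalues x)) : ℂ)) *
        star (hh.eigenvectorUnitary : Matrix Λ Λ ℂ) := by
  have hsmul : (-(β : ℂ) • h : Matrix Λ Λ ℂ) = (-β : ℝ) • h := by
    ext i j
    simp [Matrix.smul_apply, Complex.real_smul]
  have h1 : gibbsWeight β h = cfc (fun x : ℝ => Real.exp ((-β) • x)) h := by
    rw [gibbsWeight, hsmul, cfc_comp_smul (-β) Real.exp h, CFC.real_exp_eq_normedSpace_exp]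
  rw [h1, hh.cfc_eq, IsHermitian.cfc, Unitary.conjStarAlgAut_apply]
  simp only [smul_eq_mul, neg_mul]
  rfl

/-- **The spin-twisted free-fermion trace formula.** For a Hermitian one-body matrix `h₀` on the
sites, real `β` and complex twist parameters `f : Fin 2 → ℂ`:
`tr (exp (Σ_σ f_σ N_σ) · e^{-β dΓ(h₀ ⊕ h₀)}) = ∏_σ det(1 + e^{f_σ} e^{-βh₀})`, `N_σ = Σ_x n_{xσ}`
(`f = (iφ, iχ)`: the twisted traces of the `(N↑, N↓)` projections; `f_σ = βμ_σ`: spin-resolved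
grand-canonical weights). Dereziński–Gérard §17.2 (`Tr Γ(γ) = det(𝟙 + γ)`, `γ = ⊕_σ e^{f_σ}e^{-βh₀}`).
[cite: DerezinskiGerard2022, §17.2 (Density matrix, display before Def. 17.36)] -/
theorem trace_exp_spinTwist_mul_gibbsWeight_dGamma {h₀ : Matrix Λ Λ ℂ} (hh : h₀.IsHermitian)
    (β : ℝ) (f : Fin 2 → ℂ) :
    (exp (∑ σ : Fin 2, f σ • ∑ x : Λ, numberAt (orb x σ)) *
        gibbsWeight β (dGamma (Matrix.reindex (toLex : Λ × Fin 2 ≃ Orb Λ) toLex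
          (blockDiagonal fun _ : Fin 2 => h₀)))).trace =
      ∏ σ, (1 + Complex.exp (f σ) • gibbsWeight β h₀).det := by
  set D : Matrix (Orb Λ) (Orb Λ) ℂ := diagonal fun o : Orb Λ => f (ofLex o).2 with hDdef
  set hO : Matrix (Orb Λ) (Orb Λ) ℂ := Matrix.reindex (toLex : Λ × Fin 2 ≃ Orb Λ) toLex
    (blockDiagonal fun _ : Fin 2 => h₀) with hhOdef
  set U₀ : Matrix.unitaryGroup Λ ℂ := hh.eigenvectorUnitary with hU₀
  set ev : Λ → ℝ := hh.eigenvalues with hev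
  -- (1) the product of exponentials is `exp (dΓ (D - β hO))`
  have hcomm : Commute (dGamma D) (-(β : ℂ) • dGamma hO) :=
    (commute_dGamma_of_commute (commute_diagonal_spin_reindex_blockDiagonal f h₀)).smul_right _
  have hprod : exp (∑ σ : Fin 2, f σ • ∑ x : Λ, numberAt (orb x σ)) * gibbsWeight β (dGamma hO) =
      exp (dGamma (D - (β : ℂ) • hO)) := by
    rw [sum_smul_spinNumber_eq_dGamma, gibbsWeight, ← Matrix.exp_add_of_commute _ _ hcomm,
      ← dGamma_smul, ← dGamma_add, neg_smul, ← sub_eq_add_neg]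
  -- (2) `D - β hO = ⊕_σ (f_σ 1 - β h₀)` is unitarily diagonalised by `U₀ ⊕ U₀`
  have hspec : h₀ = (U₀ : Matrix Λ Λ ℂ) * diagonal (RCLike.ofReal ∘ ev) * star (U₀ : Matrix Λ Λ ℂ) := by
    have := hh.spectral_theorem
    rw [Unitary.conjStarAlgAut_apply] at this
    exact this
  have hUU : (U₀ : Matrix Λ Λ ℂ) * star (U₀ : Matrix Λ Λ ℂ) = 1 := Unitary.coe_mul_star_self U₀
  set UO : Matrix (Orb Λ) (Orb Λ) ℂ := Matrix.reindex (toLex : Λ × Fin 2 ≃ Orb Λ) toLex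
    (blockDiagonal fun _ : Fin 2 => (U₀ : Matrix Λ Λ ℂ)) with hUOdef
  have hUOstar : star UO = Matrix.reindex (toLex : Λ × Fin 2 ≃ Orb Λ) toLex
      (blockDiagonal fun _ : Fin 2 => star (U₀ : Matrix Λ Λ ℂ)) := by
    rw [hUOdef, star_eq_conjTranspose, reindex_blockDiagonal_conjTranspose]
    rfl
  have hUOmem : UO ∈ Matrix.unitaryGroup (Orb Λ) ℂ := by
    rw [Matrix.mem_unitaryGroup_iff, hUOstar, hUOdef, reindex_blockDiagonal_mul]
    simp only [hUU]
    exact reindex_blockDiagonal_one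
  -- conjugating a diagonal matrix by `U₀ ⊕ U₀`
  have hconj : ∀ v : Fin 2 → Λ → ℂ,
      UO * diagonal (fun o : Orb Λ => v (ofLex o).2 (ofLex o).1) * star UO =
        Matrix.reindex (toLex : Λ × Fin 2 ≃ Orb Λ) toLex (blockDiagonal fun σ =>
          (U₀ : Matrix Λ Λ ℂ) * diagonal (v σ) * star (U₀ : Matrix Λ Λ ℂ)) := by
    intro v
    rw [hUOstar, hUOdef, ← reindex_blockDiagonal_diagonal, reindex_blockDiagonal_mul,
      reindex_blockDiagonal_mul]
  -- the eigen-decomposition of `f_σ 1 - β h₀`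
  set d : Orb Λ → ℂ := fun o => f (ofLex o).2 - (β : ℂ) * ((ev (ofLex o).1 : ℝ) : ℂ) with hd
  have hX : D - (β : ℂ) • hO = UO * diagonal d * star UO := by
    have h1 := hconj (fun σ x => f σ - (β : ℂ) * ((ev x : ℝ) : ℂ))
    rw [hd, h1]
    have h2 : ∀ σ : Fin 2, (U₀ : Matrix Λ Λ ℂ) * diagonal (fun x => f σ - (β : ℂ) * ((ev x : ℝ) : ℂ)) *
        star (U₀ : Matrix Λ Λ ℂ) = f σ • (1 : Matrix Λ Λ ℂ) - (β : ℂ) • h₀ := by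
      intro σ
      have h3 : diagonal (fun x => f σ - (β : ℂ) * ((ev x : ℝ) : ℂ)) =
          f σ • (1 : Matrix Λ Λ ℂ) - (β : ℂ) • diagonal (RCLike.ofReal ∘ ev) := by
        rw [smul_one_eq_diagonal, ← diagonal_smul, ← diagonal_sub]
        rfl
      rw [h3, Matrix.mul_sub, Matrix.sub_mul, Matrix.mul_smul, Matrix.smul_mul, Matrix.mul_one, hUU,
        Matrix.mul_smul, Matrix.smul_mul, ← hspec]
    simp only [h2]
    rw [hDdef, hhOdef, ← reindex_blockDiagonal_diagonal (fun σ _ => f σ), reindex_blockDiagonal_smul,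
      reindex_blockDiagonal_sub]
    congr 2
    funext σ
    rw [smul_one_eq_diagonal]
  -- (3) the trace formula for the unitarily diagonalised one-body matrix
  have htrace := trace_exp_dGamma_unitary_conj_diagonal ⟨UO, hUOmem⟩ d
  simp only at htrace
  rw [hprod, hX, htrace]
  -- (4) `det (1 + exp (UO diag d UO⋆)) = ∏_σ det (1 + e^{f_σ} e^{-βh₀})`
  have hUOinv : UO⁻¹ = star UO := Matrix.inv_eq_left_inv ((Matrix.mem_unitaryGroup_iff').mp hUOmem)
  have hUnit : IsUnit UO := by
    rw [Matrix.isUnit_iff_isUnit_det]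
    have h := congrArg Matrix.det (Matrix.mem_unitaryGroup_iff.mp hUOmem)
    rw [det_mul, det_one] at h
    exact isUnit_iff_exists_inv.mpr ⟨_, h⟩
  have hexp : exp (UO * diagonal d * star UO) = UO * diagonal (fun o => Complex.exp (d o)) * star UO := by
    rw [← hUOinv, Matrix.exp_conj _ _ hUnit, Matrix.exp_diagonal]
    congr 2
    funext o
    rw [Pi.exp_def, Complex.exp_eq_exp_ℂ]
  have hed : (fun o : Orb Λ => Complex.exp (d o)) = fun o : Orb Λ =>
      Complex.exp (f (ofLex o).2) * (Real.exp (-(β * ev (ofLex o).1)) : ℂ) := by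
    funext o
    simp only [hd]
    rw [Complex.ofReal_exp, ← Complex.exp_add]
    congr 1
    push_cast
    ring
  have hconj' := hconj (fun σ x => Complex.exp (f σ) * (Real.exp (-(β * ev x)) : ℂ))
  rw [hexp, hed, hconj', ← reindex_blockDiagonal_one, reindex_blockDiagonal_add,
    det_reindex_blockDiagonal]
  refine Finset.prod_congr rfl fun σ _ => ?_
  have hdiag : (diagonal fun x => Complex.exp (f σ) * (Real.exp (-(β * ev x)) : ℂ)) =
      Complex.exp (f σ) • diagonal (fun x => (Real.exp (-(β * ev x)) : ℂ)) := by
    rw [← diagonal_smul]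
    rfl
  rw [hdiag, Matrix.mul_smul, Matrix.smul_mul, gibbsWeight_eq_eigenvectorUnitary_mul_diagonal hh β]

/-! ### The free Hubbard model -/

section Hubbard

variable (G : SimpleGraph Λ) [DecidableRel G.Adj]

omit [Fintype Λ] in
/-- **The Hubbard one-body matrix is the spin lift of the site hopping matrix**:
`hubbardOneBody G t μ = h_sp ⊕ h_sp`, `h_sp = -t·[x ∼ y] - μ δ_{xy}`. BGM 2006 (1.1) at `U = 0`.
[folklore] -/
theorem hubbardOneBody_eq_reindex_blockDiagonal (t μ : ℝ) :
    hubbardOneBody G t μ = Matrix.reindex (toLex : Λ × Fin 2 ≃ Orb Λ) toLex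
      (blockDiagonal fun _ : Fin 2 => Matrix.of fun x y : Λ =>
        (if G.Adj x y then -(t : ℂ) else 0) - (if x = y then (μ : ℂ) else 0)) := by
  ext o o'
  rw [hubbardOneBody_apply, reindex_blockDiagonal_apply, Matrix.of_apply]
  by_cases hσ : (ofLex o).2 = (ofLex o').2
  · rw [if_pos hσ]
    have ho : o = o' ↔ (ofLex o).1 = (ofLex o').1 := by
      constructor
      · intro h
        rw [h]
      · intro h
        exact ofLex.injective (Prod.ext h hσ)
    simp only [hσ, and_true, ho]
  · rw [if_neg hσ]
    have ho : o ≠ o' := fun h => hσ (by rw [h])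
    simp [hσ, ho]

omit [Fintype Λ] in
/-- The site hopping matrix `-t·[x ∼ y] - μ δ_{xy}` is Hermitian. [folklore] -/
theorem isHermitian_siteHopping (t μ : ℝ) :
    (Matrix.of fun x y : Λ =>
      (if G.Adj x y then -(t : ℂ) else 0) - (if x = y then (μ : ℂ) else 0)).IsHermitian := by
  refine Matrix.IsHermitian.ext fun x y => ?_
  simp only [Matrix.of_apply, star_sub, apply_ite star, star_neg, Complex.star_def,
    Complex.conj_ofReal, star_zero, G.adj_comm, eq_comm]

/-- **The spin-twisted trace formula for the free Hubbard model** (`U = 0`):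
`tr (exp (Σ_σ f_σ N_σ) e^{-β(H(t,0) - μN)}) = ∏_σ det(1 + e^{f_σ} e^{-βh_sp})`,
`h_sp = -t·[x ∼ y] - μ δ_{xy}` (the fermions integrate to one determinant per spin species, the
twists acting as imaginary spin-resolved chemical potentials). Dereziński–Gérard §17.2; BGM 2006
§2.1. [folklore] -/
theorem trace_exp_spinTwist_mul_gibbsWeight_freeHubbard (t μ β : ℝ) (f : Fin 2 → ℂ) :
    (exp (∑ σ : Fin 2, f σ • ∑ x : Λ, numberAt (orb x σ)) *
        gibbsWeight β (hamiltonianWith G t 0 μ)).trace =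
      ∏ σ, (1 + Complex.exp (f σ) • gibbsWeight β (Matrix.of fun x y : Λ =>
        (if G.Adj x y then -(t : ℂ) else 0) - (if x = y then (μ : ℂ) else 0))).det := by
  rw [hamiltonianWith_zero_eq_dGamma, hubbardOneBody_eq_reindex_blockDiagonal]
  exact trace_exp_spinTwist_mul_gibbsWeight_dGamma (isHermitian_siteHopping G t μ) β f

end Hubbard

end Literature.MathematicalPhysics.QuantumLattice
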